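import Literature.MathematicalPhysics.QuantumFieldTheory.Balaban1983to89.B4Thm110ZeroTorus

/-!
# B4 «Theorem (Proposition 2.1 of [1])», clauses (1.10), at `A = 0` on the torus — with the constants UNIFORM IN THE MASS
# `0 ≤ m² ≤ m₀²` (the print's «depending on d, M only»): a re-run of `B4Thm110ZeroTorus.thm110_zero_torus` with the mass
# quantified inside

Sequel of `B4Thm110ZeroTorus` (lit-balaban Phase-2 seat p38; route pp. 582–584 (2.34) + Lemma 2.4 + the `C^{(0)}` kernel), typed by
seat `pub-ymgap-dag-n15-e` (generation 5) of the cell `pub-ymgap` (Track-A node N15 = NE2, King-model rung), which needs the mass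
uniformity to sum King's slice estimates over scales (the slice at scale `j` carries the mass `m²(L^jη)²`, King (2.20)).
B4 = T. Bałaban, *Regularity and decay of lattice Green's functions*, Commun. Math. Phys. **89** (1983) 571–597
[cite: Balaban1983RegularityDecay] (journal page = PDF page + 570).

## WHAT IS PRINTED (verbatim, p. 573 [PDF 3]; `≦` written `≤`)

«**Theorem** (Proposition 2.1 of [1]). For α < 1 there exist positive constants δ₀, c₀, R₀ independent of A, k, Ω and depending on
d, M only, c₀ on α also, such that for e sufficiently small and for an arbitrary function f : Ω → R^N, we have … Similarly
|(D^η_{A,μ}G_k(Ω, A)f)(x)|, |(G_k(Ω, A)(x)| ≤ c₀ exp(−δ₀ dist(x, supp f))‖f‖_∞ (1.10) for x ∈ Ω, dist(x, Ω^c) ≥ R₀. … For some simple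
sets Ω, e.g. for rectangular parallelepipeds, the inequalities hold without any restrictions on the points x, x′.»  The constants
are printed INDEPENDENT OF THE MASS (p. 572 (1.6): «m² ≥ 0 and a is a positive constant close to 1»); the tree's
`thm110_zero_torus` fixes `m²` before producing `δ₀, c₀` (its docstring: «functions of d, L, a, m² only»), although its kernel input
`kerBounds_torus` is already uniform under the mass cap `(L^kε)²m² ≤ m²₊` and the only other mass-dependent constant, the `C^{(0)}`
decay rate `dK0 d L a m²` of `B5Leaf237C0Torus`, is ANTITONE in `m²`.

## WHAT THIS FILE CERTIFIES (kernel-checked, zero `sorry`)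

* `weightC_mono`, `dK0_antitone`: `m² ↦ dK0 d L a m²` is antitone on `[0, ∞)` (`c0 = (m² + 4d + a)e^{L+1}` is monotone, `rate` is
  antitone in the smallness constant);
* **`thm110_zero_torus_unif`**: for `d ≥ 1`, odd `L > 1`, `a > 0` and a MASS CAP `m₀² ≥ 0` there are `δ₀, c₀ > 0` (functions of
  `d, L, a, m₀²` only) such that for EVERY mass `0 ≤ m² ≤ m₀²`, every volume `(d, L, m, K)`, every scale `1 ≤ k ≤ K`, every fine
  site `x`, direction `μ` and source `f` with `|f| ≤ F` vanishing within fine sup-distance `D` of `x`: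
  `|(G^ε_k f)(x)| ≤ c₀e^{−δ₀·εD}F` and `|(∂^ε_μG^ε_k f)(x)| ≤ c₀e^{−δ₀·εD}F` — the proof of `thm110_zero_torus` verbatim with
  `kerBounds_torus … m₀²` and the `C^{(0)}` rate taken at the cap (`dK0 d L a m₀² ≤ dK0 d L a m²`).

NOT COVERED: `A ≠ 0`; boxes (the `B4Thm110ZeroBox` lineage); Hölder clauses.  HONEST FRAMING: statement-level reproduction of a
published theorem at `A = 0` on finite tori; nothing here is a claim about the Yang–Mills mass gap; count-neutral.
-/

namespace Literature.MathematicalPhysics.QuantumFieldTheory.Balaban1983to89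

namespace B4Thm110ZeroTorus

open Matrix B1RG242Torus B5Display136Torus B5Leaf237C0Torus B4Ineq115Torus B5Ineq137Torus B4Ineq116Torus

noncomputable section

section MassUniform

/-- The smallness constant `M₀ = c₀(4/δ₀)K(δ₀/2)` of `B4Sect5Torus` is monotone in `c₀` (for `K ≥ 0` on positives, `δ₀ > 0`).
[cite: Balaban1983RegularityDecay, (5.7) p.593] -/
theorem weightC_mono (K : ℝ → ℝ) (hK : ∀ t, 0 < t → 0 ≤ K t) {δ₀ : ℝ} (hδ : 0 < δ₀) {c c' : ℝ} (h : c ≤ c') :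
    B4Sect5Torus.weightC K c δ₀ ≤ B4Sect5Torus.weightC K c' δ₀ := by
  unfold B4Sect5Torus.weightC
  have h1 : 0 ≤ 4 / δ₀ * K (δ₀ / 2) := mul_nonneg (by positivity) (hK _ (by positivity))
  nlinarith

/-- **The `C^{(0)}` decay rate is ANTITONE in the mass**: `0 ≤ m² ≤ m′² ⟹ dK0 d L a m′² ≤ dK0 d L a m²` (`c0 = (m² + 4d + a)e^{L+1}`
grows with `m²`, `rate K γ₀ c₀ 1 = min(1/4, γ₀/(2M₀ + 1))` shrinks with `c₀`). [cite: Balaban1983RegularityDecay, (5.7) p.593; Balaban1984PropagatorsI, (1.136) p.40] -/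
theorem dK0_antitone (d L : ℕ) {a : ℝ} (ha : 0 < a) {msq msq' : ℝ} (hm : 0 ≤ msq) (h : msq ≤ msq') :
    dK0 d L a msq' ≤ dK0 d L a msq := by
  unfold dK0 B4Sect5Torus.rate
  have hK : ∀ t : ℝ, 0 < t → 0 ≤ B4Sect5Proof.latticeConst d t := fun _ ht => B4Sect5Proof.latticeConst_nonneg d ht.le
  have hc : c0 d L a msq ≤ c0 d L a msq' := by
    unfold c0
    exact mul_le_mul_of_nonneg_right (by linarith) (Real.exp_pos _).le
  have hc0 : 0 ≤ c0 d L a msq := by unfold c0; positivity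
  have hw := weightC_mono (B4Sect5Proof.latticeConst d) hK one_pos hc
  have hw0 : 0 ≤ B4Sect5Torus.weightC (B4Sect5Proof.latticeConst d) (c0 d L a msq) 1 := by
    unfold B4Sect5Torus.weightC
    exact mul_nonneg (mul_nonneg hc0 (by norm_num)) (hK _ (by norm_num))
  have hγ : 0 ≤ gamma0 L a := by
    unfold gamma0
    have : 0 ≤ min 8 a := le_min (by norm_num) ha.le
    positivity
  refine min_le_min le_rfl ?_
  exact div_le_div_of_nonneg_left hγ (by linarith) (by linarith)

/-- **B4 «THEOREM (PROPOSITION 2.1 OF [1])», CLAUSES (1.10), `A = 0`, ON THE TORUS — CONSTANTS UNIFORM IN THE MASS UNDER A CAP.**  For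
`d ≥ 1`, odd `L > 1`, `a > 0` and `m₀² ≥ 0` there are `δ₀, c₀ > 0` (functions of `d, L, a, m₀²` only) such that for EVERY mass
`0 ≤ m² ≤ m₀²`, every volume `(d, L, m, K)` with these `d, L`, every scale `1 ≤ k ≤ K`, every fine site `x`, every direction `μ` and every
source `f` with `|f| ≤ F` vanishing within fine sup-distance `D ≥ 0` of `x`:  `|(G^ε_k f)(x)| ≤ c₀e^{−δ₀·εD}F` and
`|(∂^ε_μG^ε_k f)(x)| ≤ c₀e^{−δ₀·εD}F`.  The proof of `thm110_zero_torus` with `kerBounds_torus` at the cap `m₀²` (its cap condition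
`(L^kε)²m² ≤ m₀²` holds since `L^kε ≤ 1`) and the `C^{(0)}` rate `dK0 d L a m₀² ≤ dK0 d L a m²` (`dK0_antitone`).
[cite: Balaban1983RegularityDecay, Theorem (1.10) p.573 («constants … depending on d, M only»), (2.34)–(2.39) pp.582–584, p.572 (torus);
Balaban1984PropagatorsI p.39 («with □ replaced by the whole torus»)] -/
theorem thm110_zero_torus_unif (d L : ℕ) (hd : 1 ≤ d) (hL : Odd L ∧ 1 < L) {a : ℝ} (ha : 0 < a) {m0sq : ℝ} (hm0 : 0 ≤ m0sq) :
    ∃ δ₀ c₀ : ℝ, 0 < δ₀ ∧ 0 < c₀ ∧ ∀ (P : Params), P.d = d → P.L = L → ∀ (msq : ℝ), 0 ≤ msq → msq ≤ m0sq →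
      ∀ k : ℕ, 1 ≤ k → k ≤ P.K → ∀ (x : Site P 0) (f : Site P 0 → ℝ) (F D : ℝ),
        (∀ z, |f z| ≤ F) → 0 ≤ D → (∀ z, f z ≠ 0 → D ≤ T P 0 x z) →
          |((tower P a msq).G k *ᵥ f) x| ≤ c₀ * Real.exp (-(δ₀ * (P.eps * D))) * F ∧
          ∀ μ : Fin P.d, |((deriv P 0 P.eps μ * (tower P a msq).G k) *ᵥ f) x|
            ≤ c₀ * Real.exp (-(δ₀ * (P.eps * D))) * F := by
  obtain ⟨C, δ, hC, hδ, hK⟩ := kerBounds_torus d L hd hL ha m0sq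
  -- the j = 0 constants at the cap depend on d, L, a, m₀² only; read them off any volume with these d, L
  have hP0 : ∃ P₀ : Params, P₀.d = d ∧ P₀.L = L := ⟨⟨d, L, 0, 0, hd, hL⟩, rfl, rfl⟩
  obtain ⟨P₀, hP₀d, hP₀L⟩ := hP0
  set C₀ := 2 / gamma0 L a with hC₀def
  set δ₀ := dK0 d L a m0sq with hδ₀def
  have hC₀ : 0 ≤ C₀ := by
    rw [hC₀def, ← hP₀L]; exact (div_pos two_pos (gamma0_pos (P := P₀) ha)).le
  have hδ₀ : 0 < δ₀ := by rw [hδ₀def, ← hP₀d, ← hP₀L]; exact dK0_pos (P := P₀) ha hm0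
  have hL1 : (1 : ℝ) < L := by exact_mod_cast hL.2
  refine ⟨min (δ₀ / 2) (δ / 4),
    (max C₀ (2 * C₀ * Real.exp δ₀)) * B4Sect5Proof.latticeConst d (δ₀ / 2) + a ^ 2 * cTerm d C δ * (1 / ((L : ℝ) - 1)) + 1,
    lt_min (by positivity) (by positivity), ?_, ?_⟩
  · have h1 := B4Sect5Proof.latticeConst_nonneg d (show 0 ≤ δ₀ / 2 by positivity)
    have h2 := cTerm_nonneg d hC hδ
    have h3 : 0 ≤ 1 / ((L : ℝ) - 1) := by apply div_nonneg zero_le_one; linarith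
    positivity
  intro P hPd hPL msq hmsq hmcap k hk1 hkK x f F D hF hD0 hD
  have hkm : k ≤ P.m + P.K := hkK.trans (Nat.le_add_left _ _)
  have hcap : P.spacing k ^ 2 * msq ≤ m0sq := by
    have hs1 : P.spacing k ≤ 1 := by rw [← P.spacing_K]; exact spacing_le_spacing P hkK
    have hs0 := (P.spacing_pos k).le
    calc P.spacing k ^ 2 * msq ≤ 1 * msq := mul_le_mul_of_nonneg_right (pow_le_one₀ hs0 hs1) hmsq
      _ = msq := one_mul _
      _ ≤ m0sq := hmcap
  have hKB := hK P hPd hPL msq hmsq k hkm hcap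
  subst hPd hPL
  -- the `C^{(0)}` kernel at mass `m²` decays at least at the cap rate `δ₀ = dK0 … m₀² ≤ dK0 … m²`
  have hG0 : ∀ x x' : Site P 0, |G0unit P a msq x x'| ≤ C₀ * Real.exp (-(δ₀ * T P 0 x x')) := by
    intro x x'
    refine (G0unit_decay (P := P) ha hmsq x x').trans (mul_le_mul_of_nonneg_left ?_ hC₀)
    exact Real.exp_le_exp.mpr (neg_le_neg (mul_le_mul_of_nonneg_right
      (dK0_antitone P.d P.L ha hmsq hmcap) (T_nonneg P 0 x x')))
  have hF0 : 0 ≤ F := (abs_nonneg _).trans (hF x)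
  have h1 := B4Sect5Proof.latticeConst_nonneg P.d (show 0 ≤ δ₀ / 2 by positivity)
  have h2 := cTerm_nonneg P.d hC hδ
  have h3 : 0 ≤ 1 / ((P.L : ℝ) - 1) := by apply div_nonneg zero_le_one; linarith
  have hE : 0 ≤ Real.exp (-(min (δ₀ / 2) (δ / 4) * (P.eps * D))) * F := mul_nonneg (Real.exp_pos _).le hF0
  set cBig := max C₀ (2 * C₀ * Real.exp δ₀) * B4Sect5Proof.latticeConst P.d (δ₀ / 2) +
    a ^ 2 * cTerm P.d C δ * (1 / ((P.L : ℝ) - 1)) + 1 with hcBig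
  have hv : C₀ * B4Sect5Proof.latticeConst P.d (δ₀ / 2) + a ^ 2 * cTerm P.d C δ * (1 / ((P.L : ℝ) - 1)) ≤ cBig := by
    have := mul_le_mul_of_nonneg_right (le_max_left C₀ (2 * C₀ * Real.exp δ₀)) h1
    rw [hcBig]; linarith
  have hdv : 2 * C₀ * Real.exp δ₀ * B4Sect5Proof.latticeConst P.d (δ₀ / 2) +
      a ^ 2 * cTerm P.d C δ * (1 / ((P.L : ℝ) - 1)) ≤ cBig := by
    have := mul_le_mul_of_nonneg_right (le_max_right C₀ (2 * C₀ * Real.exp δ₀)) h1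
    rw [hcBig]; linarith
  constructor
  · calc |((tower P a msq).G k *ᵥ f) x|
        ≤ (C₀ * B4Sect5Proof.latticeConst P.d (δ₀ / 2) + a ^ 2 * cTerm P.d C δ * (1 / ((P.L : ℝ) - 1))) *
            (Real.exp (-(min (δ₀ / 2) (δ / 4) * (P.eps * D))) * F) := by
          rw [← mul_assoc]; exact value_row_bound P ha hmsq hk1 hkK hkm hC hδ hC₀ hδ₀ hKB hG0 x f hF hD0 hD
      _ ≤ cBig * (Real.exp (-(min (δ₀ / 2) (δ / 4) * (P.eps * D))) * F) := mul_le_mul_of_nonneg_right hv hE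
      _ = _ := by rw [mul_assoc]
  · intro μ
    calc |((deriv P 0 P.eps μ * (tower P a msq).G k) *ᵥ f) x|
        ≤ (2 * C₀ * Real.exp δ₀ * B4Sect5Proof.latticeConst P.d (δ₀ / 2) +
            a ^ 2 * cTerm P.d C δ * (1 / ((P.L : ℝ) - 1))) *
            (Real.exp (-(min (δ₀ / 2) (δ / 4) * (P.eps * D))) * F) := by
          rw [← mul_assoc]; exact deriv_row_bound P ha hmsq hk1 hkK hkm hC hδ hC₀ hδ₀ hKB hG0 μ x f hF hD0 hD
      _ ≤ cBig * (Real.exp (-(min (δ₀ / 2) (δ / 4) * (P.eps * D))) * F) := mul_le_mul_of_nonneg_right hdv hE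
      _ = _ := by rw [mul_assoc]

end MassUniform

end

end B4Thm110ZeroTorus

end Literature.MathematicalPhysics.QuantumFieldTheory.Balaban1983to89
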